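import Mathlib
import HarnessLib
import Summits.HubbardSuperconductivity.HubbardSuperconductivity.Theorems.KLProgrammeKLRegimeTwoVolumeTowerStepCovZeroTwoFrame
import Summits.HubbardSuperconductivity.HubbardSuperconductivity.Theorems.KLProgrammeH10TwoPointLimitSymbolFrameProfile
import Summits.HubbardSuperconductivity.HubbardSuperconductivity.Theorems.KLProgrammeKLRegimeSymbolFrameProfileFourth

/-!
# K3 VL child (stmt-HubbardSuperconductivity-20440), atom `HmisCov`, block «HmisEntry» (MODEL LEVEL): the ENTRY sup of the two-frame increment
# `klStepCov V M β μ K′ (m+1) − klStepCov V M β μ K (m+1)` of every step `j = m+1 ≥ 1` — volume-free, cutoff-free (`M`), from `|e_{K′} − e_K| ≤ P₀` alone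

Cell `gate-hubbard-kl`, seat p3 (g19).  The window-key interface (`…VolumeLimitV11TowerDataWOfGridMSplit`, k3c4-p1 g17) asks for `HmisEntry`: rates
`sE j L → 0`, UNIFORM IN `M` and `b`, with `‖(klStepCov (bL) M β μ K_{bL} j − klStepCov (bL) M β μ K_L j) x y‖ ≤ sE j L` (`j < n_β`).  The rows of the
same matrix (k3c4-p1's `hmisCovRowsPos_of_towerP`, p3 g16's #23 telescope) carry `M/β` and need the full jet data; the ENTRY needs neither: with
`klStepCov[K′] − klStepCov[K] = [S(F̃′)ᵀC^{K′}S(F̃′) − S(F̃)ᵀC^{K′}S(F̃)] + S(F̃)ᵀ(C^{K′} − C^{K})S(F̃)` (`F̃ = F̃_{m+1}[K]`, `F̃′ = F̃_{m+1}[K′]`),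

* §1 `abs_bgmCutoffSq_sub_le` (mean value), **`norm_bgmFatMultiplier_frame_sub_le`**: `‖F̃_{m+1}[K′]_ω(k) − F̃_{m+1}[K]_ω(k)‖ ≤ d·16^m·P₀·(2e₀+P₀)`
  (`d` = the sup of `|bgmCutoffSq′|`, p3 `exists_abs_derivs4_bgmCutoffSq_le`; the angular factor is frame-free and in `[0,1]`; off the radial support of
  BOTH frames the difference vanishes, on it `|e| ≤ e₀`), `norm_bgmFat_pair_frame_sub_le` (the pair form, `δ₂ = 2·d·16^m·P₀·(2e₀+P₀)`);
* §2 `norm_pullback_normalCovariance_familySub_le_of_sum` — GENERIC: `‖(S(F′)ᵀN_pS(F′) − S(F)ᵀN_pS(F)) Y Y′‖ ≤ ‖(βV²)⁻¹‖²·δ₂·Σ_k ‖p(k,σ_Y)‖` for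
  `‖F′_ωF′_{ω′} − F_ωF_{ω′}‖ ≤ δ₂` (termwise on k3c2-p3's closed form; no support count of the families is needed);
  `sum_norm_sliceSymbolFreq_le` — `Σ_k ‖Ψ̂_{(Λ,Λ′]}[K](k)‖ ≤ (Λ′β/π+3)(1793Λ′V²+704V)·4c/Λ` (shell count of part 1 × `norm_sliceSymbolFnXi_le`);
* §3 **`norm_klStepCov_succ_sub_apply_le_unif`** — two admissible frames, `β ≥ 1`, `|e_{K′} − e_K| ≤ P₀ ≤ 1`:
  `‖(klStepCov V M β μ K′ (m+1) − klStepCov V M β μ K (m+1)) X Y‖ ≤ 𝒞(m, d)·P₀`,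
  `𝒞(m,d) = (Λ′/π+3)(1793Λ′+704)·(2(16·(32/3)+16)/Λ² + 8·d·16^m·(2e₀+1)/Λ)`, `Λ = Λ_{m+3}`, `Λ′ = Λ_{m+2}` — uniform in `V`, `M`, `β`.

Part 4 (`…VolumeLimitV11HmisEntryOfTowerP`) instantiates §3 and part 1 under `TowerP` (`P₀ = cst/L`).  Everything is proved; no definitions, no sorry.
Nothing asserts HmisCov, any stub, K3, VL or superconductivity.  [cite: BenfattoGiulianiMastropietro2006, §2.7 (2.66)–(2.67), §2.8 (2.80), §3 (3.2)–(3.3)]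
-/

noncomputable section

namespace Summit.HubbardSuperconductivity.HubbardSuperconductivity.Theorems.TorusFourierL2

set_option linter.dupNamespace false -- summit = problem name (single-conjunct summit), D-0017

open Set Finset Literature.MathematicalPhysics.QuantumLattice Literature.MathematicalPhysics.QuantumLattice.BandSectorCounting
open Literature.MathematicalPhysics.QuantumLattice.FermiRG Literature.Probability.LatticeModels Literature.Analysis.SpecialFunctions
open Summit.HubbardSuperconductivity.HubbardSuperconductivity.Theorems.DispersionFlow
open Summit.HubbardSuperconductivity.HubbardSuperconductivity.Theorems.KLRegimeSplit
open Summit.HubbardSuperconductivity.HubbardSuperconductivity.Theorems.KLProgrammeLegKernels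
open Summit.HubbardSuperconductivity.HubbardSuperconductivity.Theorems.PerturbedFermiCurve
open Summit.HubbardSuperconductivity.HubbardSuperconductivity.Theorems.KLRegimeWick
open Summit.HubbardSuperconductivity.HubbardSuperconductivity.Theorems.TwoVolumeSource
open scoped Real Nat

open Classical

/-! ## §1 The fat multiplier's frame increment, pointwise -/

section Fat

/-- **Mean value for the radial profile**: `|G(u′) − G(u)| ≤ d·|u′ − u|` when `|G′| ≤ d`. [folklore] -/
theorem abs_bgmCutoffSq_sub_le {e₀ : ℝ} (he : 0 < e₀) {d : ℝ} (hd : ∀ u, |deriv (bgmCutoffSq e₀) u| ≤ d) (u u' : ℝ) :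
    |bgmCutoffSq e₀ u' - bgmCutoffSq e₀ u| ≤ d * |u' - u| := by
  have hdiff : Differentiable ℝ (bgmCutoffSq e₀) := (contDiff_bgmCutoffSq he (m := 1)).differentiable (by norm_num)
  have h := Convex.norm_image_sub_le_of_norm_deriv_le (f := bgmCutoffSq e₀) (s := Set.univ) (fun x _ => hdiff x)
    (fun x _ => by rw [Real.norm_eq_abs]; exact hd x) convex_univ (Set.mem_univ u) (Set.mem_univ u')
  rwa [Real.norm_eq_abs, Real.norm_eq_abs] at h

variable {L M : ℕ} [NeZero L]

omit [NeZero L] in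
/-- **THE FAT MULTIPLIER'S FRAME INCREMENT, POINTWISE**: `‖F̃_{m+1}[K′]_ω(k) − F̃_{m+1}[K]_ω(k)‖ ≤ d·16^m·P₀·(2e₀ + P₀)` whenever `|e_{K′} − e_K| ≤ P₀` on the
torus (`d` = sup `|bgmCutoffSq′|`).  The angular factor is frame-free and in `[0,1]`; where both radial arguments exceed `e₀²` the difference vanishes,
elsewhere one band value is `≤ e₀` in modulus and the other within `P₀` of it. [cite: BenfattoGiulianiMastropietro2006, §2.7 (2.66), §3 (3.3)] -/
theorem norm_bgmFatMultiplier_frame_sub_le {e₀ : ℝ} (he : 0 < e₀) {d : ℝ} (hd0 : 0 ≤ d) (hd : ∀ u, |deriv (bgmCutoffSq e₀) u| ≤ d)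
    (β μ : ℝ) (K K' : TrigPolyC4v) (m : ℕ) {P₀ : ℝ} (hP₀ : 0 ≤ P₀) (hv₀ : ∀ k : TorusSite 2 L, |nambuXiCT L μ K' k - nambuXiCT L μ K k| ≤ P₀)
    (ω : Fin (sectorCount (m + 1))) (k : FreqMomentum L M) :
    ‖bgmFatMultiplier L M e₀ β (nambuXiCT L μ K') (m + 1) ω k - bgmFatMultiplier L M e₀ β (nambuXiCT L μ K) (m + 1) ω k‖ ≤
      d * (16 : ℝ) ^ m * P₀ * (2 * e₀ + P₀) := by
  classical
  have hidx : (-((m + 1 : ℕ) : ℤ) + 1) = -(m : ℤ) := by push_cast; ring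
  rw [bgmFatMultiplier, bgmFatMultiplier, hidx, gnScaleCutoff_sqrt_eq_bgmCutoffSq, gnScaleCutoff_sqrt_eq_bgmCutoffSq, ← Complex.ofReal_sub,
    Complex.norm_real, Real.norm_eq_abs, ← sub_mul, abs_mul]
  set ξ : ℝ := nambuXiCT L μ K k.2 with hξ
  set ξ' : ℝ := nambuXiCT L μ K' k.2 with hξ'
  set w : ℝ := matsubaraFreq β M k.1 with hw
  set S : ℝ := ∑ ω' ∈ (range (sectorCount (m + 1))).filter
      (fun ω' : ℕ => ∃ δ : ℤ, |δ| ≤ 1 ∧ (sectorCount (m + 1) : ℤ) ∣ ((ω' : ℤ) - ((ω : ℕ) : ℤ) - δ)),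
      sectorWeightCirc (m + 1) ω' (momentumAngle L k.2) with hS
  have hSI := fatSectorWeight_mem_Icc (m + 1) ((ω : ℕ) : ℤ) (momentumAngle L k.2)
  have hS0 : 0 ≤ S := hSI.1
  have hS1 : S ≤ 1 := hSI.2
  have h16 : (0 : ℝ) < (16 : ℝ) ^ m := by positivity
  have hRHS : 0 ≤ d * (16 : ℝ) ^ m * P₀ * (2 * e₀ + P₀) := by positivity
  have hPk : |ξ' - ξ| ≤ P₀ := hv₀ k.2
  -- the radial difference is at most the whole bound; the angular factor is in `[0,1]`
  suffices hG : |bgmCutoffSq e₀ ((16 : ℝ) ^ m * (w ^ 2 + ξ' ^ 2)) - bgmCutoffSq e₀ ((16 : ℝ) ^ m * (w ^ 2 + ξ ^ 2))| ≤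
      d * (16 : ℝ) ^ m * P₀ * (2 * e₀ + P₀) by
    calc _ ≤ d * (16 : ℝ) ^ m * P₀ * (2 * e₀ + P₀) * 1 := by
          rw [abs_of_nonneg hS0]; exact mul_le_mul hG hS1 hS0 hRHS
      _ = _ := mul_one _
  by_cases hout : e₀ ^ 2 < (16 : ℝ) ^ m * (w ^ 2 + ξ' ^ 2) ∧ e₀ ^ 2 < (16 : ℝ) ^ m * (w ^ 2 + ξ ^ 2)
  · rw [(bgmCutoffSq_eq_const he).2 hout.1, (bgmCutoffSq_eq_const he).2 hout.2, sub_zero, abs_zero]; exact hRHS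
  · -- one of the two radial arguments is `≤ e₀²`, so `|ξ| + |ξ′| ≤ 2e₀ + P₀`
    have hsum : |ξ| + |ξ'| ≤ 2 * e₀ + P₀ := by
      rw [not_and_or, not_lt, not_lt] at hout
      have hw2 : 0 ≤ (16 : ℝ) ^ m * w ^ 2 := by positivity
      have h16' : (1 : ℝ) ≤ (16 : ℝ) ^ m := one_le_pow₀ (by norm_num)
      rcases hout with h | h
      · have h1 : ξ' ^ 2 ≤ e₀ ^ 2 := by nlinarith [sq_nonneg ξ']
        have h2 : |ξ'| ≤ e₀ := abs_le.2 (abs_le_of_sq_le_sq' h1 he.le)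
        have h3 : |ξ| ≤ |ξ'| + P₀ := by
          have := abs_sub_abs_le_abs_sub ξ ξ'
          rw [abs_sub_comm] at this
          linarith
        linarith
      · have h1 : ξ ^ 2 ≤ e₀ ^ 2 := by nlinarith [sq_nonneg ξ]
        have h2 : |ξ| ≤ e₀ := abs_le.2 (abs_le_of_sq_le_sq' h1 he.le)
        have h3 : |ξ'| ≤ |ξ| + P₀ := by
          have := abs_sub_abs_le_abs_sub ξ' ξ
          linarith
        linarith
    calc _ ≤ d * |(16 : ℝ) ^ m * (w ^ 2 + ξ' ^ 2) - (16 : ℝ) ^ m * (w ^ 2 + ξ ^ 2)| := abs_bgmCutoffSq_sub_le he hd _ _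
      _ = d * (16 : ℝ) ^ m * (|ξ' - ξ| * |ξ' + ξ|) := by
          rw [show (16 : ℝ) ^ m * (w ^ 2 + ξ' ^ 2) - (16 : ℝ) ^ m * (w ^ 2 + ξ ^ 2) = (16 : ℝ) ^ m * ((ξ' - ξ) * (ξ' + ξ)) by ring,
            abs_mul, abs_mul, abs_of_pos h16]; ring
      _ ≤ d * (16 : ℝ) ^ m * (P₀ * (2 * e₀ + P₀)) := by
          refine mul_le_mul_of_nonneg_left (mul_le_mul hPk ((abs_add_le ξ' ξ).trans (by linarith)) (abs_nonneg _) hP₀) (by positivity)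
      _ = _ := by ring

omit [NeZero L] in
/-- **The pair form**: `‖F̃′_ωF̃′_{ω′} − F̃_ωF̃_{ω′}‖ ≤ 2·d·16^m·P₀·(2e₀ + P₀)` (both factors have norm `≤ 1`). [cite: BenfattoGiulianiMastropietro2006, §3 (3.3)] -/
theorem norm_bgmFat_pair_frame_sub_le {e₀ : ℝ} (he : 0 < e₀) {d : ℝ} (hd0 : 0 ≤ d) (hd : ∀ u, |deriv (bgmCutoffSq e₀) u| ≤ d)
    (β μ : ℝ) (K K' : TrigPolyC4v) (m : ℕ) {P₀ : ℝ} (hP₀ : 0 ≤ P₀) (hv₀ : ∀ k : TorusSite 2 L, |nambuXiCT L μ K' k - nambuXiCT L μ K k| ≤ P₀)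
    (ω ω' : Fin (sectorCount (m + 1))) (k : FreqMomentum L M) :
    ‖bgmFatMultiplier L M e₀ β (nambuXiCT L μ K') (m + 1) ω k * bgmFatMultiplier L M e₀ β (nambuXiCT L μ K') (m + 1) ω' k -
        bgmFatMultiplier L M e₀ β (nambuXiCT L μ K) (m + 1) ω k * bgmFatMultiplier L M e₀ β (nambuXiCT L μ K) (m + 1) ω' k‖ ≤
      2 * (d * (16 : ℝ) ^ m * P₀ * (2 * e₀ + P₀)) := by
  set a' := bgmFatMultiplier L M e₀ β (nambuXiCT L μ K') (m + 1) ω k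
  set b' := bgmFatMultiplier L M e₀ β (nambuXiCT L μ K') (m + 1) ω' k
  set a := bgmFatMultiplier L M e₀ β (nambuXiCT L μ K) (m + 1) ω k
  set b := bgmFatMultiplier L M e₀ β (nambuXiCT L μ K) (m + 1) ω' k
  have h1 := norm_bgmFatMultiplier_frame_sub_le (M := M) he hd0 hd β μ K K' m hP₀ hv₀ ω k
  have h2 := norm_bgmFatMultiplier_frame_sub_le (M := M) he hd0 hd β μ K K' m hP₀ hv₀ ω' k
  have hb' : ‖b'‖ ≤ 1 := norm_bgmFatMultiplier_le_one _ _ _ _ _ _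
  have ha : ‖a‖ ≤ 1 := norm_bgmFatMultiplier_le_one _ _ _ _ _ _
  have e : a' * b' - a * b = (a' - a) * b' + a * (b' - b) := by ring
  rw [e]
  calc ‖(a' - a) * b' + a * (b' - b)‖ ≤ ‖a' - a‖ * ‖b'‖ + ‖a‖ * ‖b' - b‖ := by
        refine (norm_add_le _ _).trans ?_; rw [norm_mul, norm_mul]
    _ ≤ d * (16 : ℝ) ^ m * P₀ * (2 * e₀ + P₀) * 1 + 1 * (d * (16 : ℝ) ^ m * P₀ * (2 * e₀ + P₀)) := by
        gcongr
    _ = _ := by ring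

end Fat

/-! ## §2 The entry of a family defect by the symbol's `ℓ¹` sum; the slice symbol's `ℓ¹` sum over the shell -/

section FamilyEntry

variable {V M N : ℕ} [NeZero V] [NeZero M]

omit [NeZero M] in
/-- **Entry of a family defect `S(F′)ᵀN_pS(F′) − S(F)ᵀN_pS(F)` by the symbol's `ℓ¹` sum**: if `‖F′_ω(k)F′_{ω′}(k) − F_ω(k)F_{ω′}(k)‖ ≤ δ₂` for all
`ω, ω′, k`, then every entry is `≤ ‖(βV²)⁻¹‖²·(δ₂·Σ_k ‖p(k, σ_Y)‖)` (termwise on the closed form; plane waves have modulus one).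
[cite: BenfattoGiulianiMastropietro2006, §2.7 (2.66)–(2.67), §3 (3.3)] -/
theorem norm_pullback_normalCovariance_familySub_le_of_sum (β : ℝ) (F' F : Fin N → FreqMomentum V M → ℂ) (p : FreqMomentum V M × Fin 2 → ℂ)
    {δ₂ : ℝ} (hδ0 : 0 ≤ δ₂) (hδ : ∀ (ω ω' : Fin N) (k : FreqMomentum V M), ‖F' ω k * F' ω' k - F ω k * F ω' k‖ ≤ δ₂)
    (Y Y' : SpaceTimeIdx V M × SectorLeg N) :
    ‖((sectorSubMatrix V M β F').transpose * normalCovariance V M p * sectorSubMatrix V M β F' -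
        (sectorSubMatrix V M β F).transpose * normalCovariance V M p * sectorSubMatrix V M β F) Y Y'‖ ≤
      ‖((1 / (β * (V : ℝ) ^ 2) : ℝ) : ℂ)‖ ^ 2 * (δ₂ * ∑ k : FreqMomentum V M, ‖p (k, Y.2.1.2)‖) := by
  classical
  have hRHS : 0 ≤ ‖((1 / (β * (V : ℝ) ^ 2) : ℝ) : ℂ)‖ ^ 2 * (δ₂ * ∑ k : FreqMomentum V M, ‖p (k, Y.2.1.2)‖) := by positivity
  rw [Matrix.sub_apply, sectorSub_pullback_normalCovariance_apply, sectorSub_pullback_normalCovariance_apply]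
  by_cases hσ : Y.2.1.2 = Y'.2.1.2
  · rw [if_pos hσ, if_pos hσ, ← Finset.sum_sub_distrib]
    refine (norm_sum_le _ _).trans ?_
    rw [Finset.mul_sum, Finset.mul_sum]
    refine Finset.sum_le_sum fun k _ => ?_
    have hw : ∀ (c : Fin 2) (x : SpaceTimeIdx V M), ‖(starRingEnd ℂ) (hubbardPlaneWave V M β c k x)‖ = 1 :=
      fun c x => by rw [RCLike.norm_conj, norm_hubbardPlaneWave]
    set c₀ : ℂ := ((1 / (β * (V : ℝ) ^ 2) : ℝ) : ℂ)
    set ea := (starRingEnd ℂ) (hubbardPlaneWave V M β Y.2.2 k Y.1)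
    set eb := (starRingEnd ℂ) (hubbardPlaneWave V M β Y'.2.2 k Y'.1)
    set q := (if Y.2.2 = 0 ∧ Y'.2.2 = 1 then p (k, Y.2.1.2) else if Y.2.2 = 1 ∧ Y'.2.2 = 0 then -p (k, Y.2.1.2) else 0) with hqdef
    have hq : ‖q‖ ≤ ‖p (k, Y.2.1.2)‖ := by
      rw [hqdef]
      split_ifs
      · exact le_rfl
      · rw [norm_neg]
      · rw [norm_zero]; exact norm_nonneg _
    have e : c₀ * (F' Y.2.1.1 k * ea) * q * (c₀ * (F' Y'.2.1.1 k * eb)) - c₀ * (F Y.2.1.1 k * ea) * q * (c₀ * (F Y'.2.1.1 k * eb)) =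
        c₀ * c₀ * ea * eb * q * (F' Y.2.1.1 k * F' Y'.2.1.1 k - F Y.2.1.1 k * F Y'.2.1.1 k) := by ring
    rw [e, norm_mul, norm_mul, norm_mul, norm_mul, norm_mul, hw, hw, mul_one, mul_one]
    calc ‖c₀‖ * ‖c₀‖ * ‖q‖ * ‖F' Y.2.1.1 k * F' Y'.2.1.1 k - F Y.2.1.1 k * F Y'.2.1.1 k‖ ≤ ‖c₀‖ * ‖c₀‖ * ‖p (k, Y.2.1.2)‖ * δ₂ := by
          gcongr
          exact hδ _ _ k
      _ = ‖c₀‖ ^ 2 * (δ₂ * ‖p (k, Y.2.1.2)‖) := by ring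
  · rw [if_neg hσ, if_neg hσ, sub_zero, norm_zero]; exact hRHS

omit [NeZero M] in
/-- **The slice symbol's `ℓ¹` sum over all frequency–momentum labels** (admissible frame, `0 < Λ ≤ Λ′ < 3/80`, `c ≥ 0`):
`Σ_k ‖Ψ̂_{(Λ,Λ′]}(ω(k), e_K(k⃗))‖ ≤ (Λ′β/π+3)(1793Λ′V²+704V)·(4c/Λ)` (support in the shell, sup `4c/Λ`).
[cite: BenfattoGiulianiMastropietro2006, §2.3 (2.19), §2.8 (2.80)] -/
theorem sum_norm_sliceSymbolFreq_le {R : RenConsts} {U : ℝ} {N : ℕ} {μ : ℝ} {K : TrigPolyC4v} (hK : FrameOK R U N μ K) {β : ℝ} (hβ : 0 < β)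
    {c : ℝ} (hc : 0 ≤ c) {Λ Λ' : ℝ} (hΛ : 0 < Λ) (hΛΛ' : Λ ≤ Λ') (hΛ' : Λ' < 3 / 80) :
    ∑ k : FreqMomentum V M, ‖sliceSymbolFnXi c 0 Λ Λ' (matsubaraFreq β M k.1) (nambuXiCT V μ K k.2)‖ ≤
      (Λ' * β / π + 3) * (1793 * Λ' * (V : ℝ) ^ 2 + 704 * V) * (4 * c / Λ) := by
  have hΛ'0 : 0 ≤ Λ' := hΛ.le.trans hΛΛ'
  set f : FreqMomentum V M → ℝ := fun k => ‖sliceSymbolFnXi c 0 Λ Λ' (matsubaraFreq β M k.1) (nambuXiCT V μ K k.2)‖ with hf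
  set B := (univ : Finset (FreqMomentum V M)).filter fun k => |matsubaraFreq β M k.1| ≤ Λ' ∧ |nambuXiCT V μ K k.2| ≤ Λ' with hB
  have hzero : ∀ k : FreqMomentum V M, k ∉ B → f k = 0 := by
    intro k hk
    rw [hB, mem_filter, not_and] at hk
    have h2 : sliceSymbolFnXi c 0 Λ Λ' (matsubaraFreq β M k.1) (nambuXiCT V μ K k.2) = 0 :=
      sliceSymbolFnXi_eq_zero_of_not_shell hΛ hΛΛ' (hk (mem_univ _))
    simp only [hf, h2, norm_zero]
  have hsum : ∑ k, f k = ∑ k ∈ B, f k := (Finset.sum_subset (subset_univ _) fun k _ hk => hzero k hk).symm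
  have hBc : ((B.card : ℕ) : ℝ) ≤ (Λ' * β / π + 3) * (1793 * Λ' * (V : ℝ) ^ 2 + 704 * V) := card_shell_freqMomentum_le hK hβ hΛ'0 hΛ'
  have hS0 : 0 ≤ 4 * c / Λ := by positivity
  show ∑ k, f k ≤ _
  rw [hsum]
  calc ∑ k ∈ B, f k ≤ ∑ _k ∈ B, 4 * c / Λ := sum_le_sum fun k _ => norm_sliceSymbolFnXi_le hΛ hΛΛ' hc _
    _ = ((B.card : ℕ) : ℝ) * (4 * c / Λ) := by rw [sum_const, nsmul_eq_mul]
    _ ≤ _ := mul_le_mul_of_nonneg_right hBc hS0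

end FamilyEntry

/-! ## §3 The entry of the two-frame increment of the step covariance at every step `j = m+1 ≥ 1` -/

section StepEntry

variable {V M : ℕ} [NeZero V] [NeZero M]

omit [NeZero M] in
/-- The shell prefactor algebra: `(βV²)⁻²·(Λ′β/π+3)(1793Λ′V²+704V)·(βV²·X) ≤ (Λ′/π+3)(1793Λ′+704)·X` for `β, V ≥ 1`, `X, Λ′ ≥ 0`. [folklore] -/
theorem shell_prefactor_le {β Λ' X : ℝ} (hβ1 : 1 ≤ β) (hΛ' : 0 ≤ Λ') (hX : 0 ≤ X) :
    (1 / (β * (V : ℝ) ^ 2)) ^ 2 * ((Λ' * β / π + 3) * (1793 * Λ' * (V : ℝ) ^ 2 + 704 * V)) * (β * (V : ℝ) ^ 2 * X) ≤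
      (Λ' / π + 3) * (1793 * Λ' + 704) * X := by
  have hβ : 0 < β := lt_of_lt_of_le one_pos hβ1
  have hV1 : (1 : ℝ) ≤ V := by exact_mod_cast Nat.pos_of_ne_zero (NeZero.ne V)
  have hV : (0 : ℝ) < V := lt_of_lt_of_le one_pos hV1
  have h1 : Λ' * β / π + 3 ≤ (Λ' / π + 3) * β := by
    rw [add_mul, div_mul_eq_mul_div, mul_comm Λ' β, mul_div_assoc, mul_comm β (Λ' / π)]
    have : (3 : ℝ) ≤ 3 * β := by nlinarith
    nlinarith [this]
  have h2 : 1793 * Λ' * (V : ℝ) ^ 2 + 704 * V ≤ (1793 * Λ' + 704) * (V : ℝ) ^ 2 := by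
    have : (704 : ℝ) * V ≤ 704 * (V : ℝ) ^ 2 := by nlinarith
    nlinarith [this]
  have hA0 : 0 ≤ Λ' * β / π + 3 := by positivity
  have hB0 : 0 ≤ 1793 * Λ' * (V : ℝ) ^ 2 + 704 * V := by positivity
  calc (1 / (β * (V : ℝ) ^ 2)) ^ 2 * ((Λ' * β / π + 3) * (1793 * Λ' * (V : ℝ) ^ 2 + 704 * V)) * (β * (V : ℝ) ^ 2 * X)
      ≤ (1 / (β * (V : ℝ) ^ 2)) ^ 2 * (((Λ' / π + 3) * β) * ((1793 * Λ' + 704) * (V : ℝ) ^ 2)) * (β * (V : ℝ) ^ 2 * X) := by gcongr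
    _ = (Λ' / π + 3) * (1793 * Λ' + 704) * X := by field_simp

/-- **THE ENTRY OF THE TWO-FRAME INCREMENT OF THE STEP COVARIANCE AT STEP `m+1`** (two admissible frames, `β ≥ 1`, `|e_{K′} − e_K| ≤ P₀ ≤ 1`, `d` = sup
`|bgmCutoffSq′|`): `‖(klStepCov V M β μ K′ (m+1) − klStepCov V M β μ K (m+1)) X Y‖ ≤ 𝒞(m,d)·P₀`,
`𝒞(m,d) = (Λ′/π+3)(1793Λ′+704)·(2(16·(32/3)+16)/Λ² + 8·d·16^m·(2e₀+1)/Λ)`, `Λ = Λ_{m+3}`, `Λ′ = Λ_{m+2}` — uniform in `V`, `M`, `β`.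
[cite: BenfattoGiulianiMastropietro2006, §2.7 (2.66)–(2.67), §2.8 (2.80), §3 (3.2)–(3.3)] -/
theorem norm_klStepCov_succ_sub_apply_le_unif {R R' : RenConsts} {U U' : ℝ} {N N' : ℕ} {μ : ℝ} {K K' : TrigPolyC4v}
    (hK : FrameOK R U N μ K) (hK' : FrameOK R' U' N' μ K') {β : ℝ} (hβ1 : 1 ≤ β) {d : ℝ} (hd0 : 0 ≤ d) (hd : ∀ u, |deriv (bgmCutoffSq klE0) u| ≤ d)
    (m : ℕ) {P₀ : ℝ} (hP₀ : 0 ≤ P₀) (hP₁ : P₀ ≤ 1) (hv₀ : ∀ p, |frameLevel μ K' p - frameLevel μ K p| ≤ P₀)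
    (X Y : SpaceTimeIdx V M × SectorLeg (sectorCount (m + 1))) :
    ‖(klStepCov V M β μ K' (m + 1) - klStepCov V M β μ K (m + 1)) X Y‖ ≤
      (klScale klE0 (m + 2) / π + 3) * (1793 * klScale klE0 (m + 2) + 704) *
        (2 * (16 * (32 / 3) + 16) / klScale klE0 (m + 3) ^ 2 + 8 * d * (16 : ℝ) ^ m * (2 * klE0 + 1) / klScale klE0 (m + 3)) * P₀ := by
  have hβ : 0 < β := lt_of_lt_of_le one_pos hβ1
  have he : (0 : ℝ) < klE0 := by norm_num [klE0]
  set Λ : ℝ := klScale klE0 (m + 3) with hΛdef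
  set Λ' : ℝ := klScale klE0 (m + 2) with hΛ'def
  have hΛ : 0 < Λ := klth_klScale_pos (m + 3)
  have hΛ'pos : 0 < Λ' := klth_klScale_pos (m + 2)
  have hΛΛ' : Λ ≤ Λ' := EngineV8.klScale_le_klScale he.le (by omega)
  have hΛ't : Λ' < 3 / 80 := klScale_klE0_lt_tube (m + 2)
  -- the torus version of the band increment
  have hv₀' : ∀ k : TorusSite 2 V, |nambuXiCT V μ K' k - nambuXiCT V μ K k| ≤ P₀ := fun k => by rw [nambuXiCT_sub_eq]; exact hv₀ _
  -- the objects
  set F := bgmFatMultiplier V M klE0 β (nambuXiCT V μ K) (m + 1) with hF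
  set F' := bgmFatMultiplier V M klE0 β (nambuXiCT V μ K') (m + 1) with hF'
  set C := hubbardCovSliceCT V M β μ 0 K Λ Λ' with hC
  set C' := hubbardCovSliceCT V M β μ 0 K' Λ Λ' with hC'
  have hstep : ∀ K₁ : TrigPolyC4v, klStepCov V M β μ K₁ (m + 1) =
      (sectorSubMatrix V M β (bgmFatMultiplier V M klE0 β (nambuXiCT V μ K₁) (m + 1))).transpose * hubbardCovSliceCT V M β μ 0 K₁ Λ Λ' *
        sectorSubMatrix V M β (bgmFatMultiplier V M klE0 β (nambuXiCT V μ K₁) (m + 1)) := fun K₁ => rfl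
  have hsplit : klStepCov V M β μ K' (m + 1) - klStepCov V M β μ K (m + 1) =
      ((sectorSubMatrix V M β F').transpose * C' * sectorSubMatrix V M β F' - (sectorSubMatrix V M β F).transpose * C' * sectorSubMatrix V M β F) +
        (sectorSubMatrix V M β F).transpose * (C' - C) * sectorSubMatrix V M β F := by
    rw [hstep K', hstep K, Matrix.mul_sub, Matrix.sub_mul]
    abel
  rw [hsplit, Matrix.add_apply]
  refine (norm_add_le _ _).trans ?_
  -- (i) the family piece: `δ₂ = 2·d·16^m·P₀·(2e₀+P₀) ≤ 2d16^m(2e₀+1)·P₀`, symbol sum over the shell of `K′`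
  have hδ := norm_bgmFat_pair_frame_sub_le (M := M) he hd0 hd β μ K K' m hP₀ hv₀'
  have hfam : ‖((sectorSubMatrix V M β F').transpose * C' * sectorSubMatrix V M β F' -
      (sectorSubMatrix V M β F).transpose * C' * sectorSubMatrix V M β F) X Y‖ ≤
      (Λ' / π + 3) * (1793 * Λ' + 704) * (8 * d * (16 : ℝ) ^ m * (2 * klE0 + 1) / Λ) * P₀ := by
    rw [hC', hubbardCovSliceCT_eq_normalCovariance_sliceSymbolFnXi hβ.ne' μ K' Λ Λ']
    refine (norm_pullback_normalCovariance_familySub_le_of_sum β F' F _ (by positivity) hδ X Y).trans ?_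
    have hsum := sum_norm_sliceSymbolFreq_le (V := V) (M := M) hK' hβ (c := β * (V : ℝ) ^ 2) (by positivity) hΛ hΛΛ' hΛ't
    have hc0 : ‖((1 / (β * (V : ℝ) ^ 2) : ℝ) : ℂ)‖ = 1 / (β * (V : ℝ) ^ 2) := by
      rw [Complex.norm_real, Real.norm_of_nonneg (by positivity)]
    rw [hc0]
    have hP2 : 2 * klE0 + P₀ ≤ 2 * klE0 + 1 := by linarith
    calc (1 / (β * (V : ℝ) ^ 2)) ^ 2 * (2 * (d * (16 : ℝ) ^ m * P₀ * (2 * klE0 + P₀)) *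
            ∑ k : FreqMomentum V M, ‖sliceSymbolFnXi (β * (V : ℝ) ^ 2) 0 Λ Λ' (matsubaraFreq β M (k, Y.2.1.2).1.1) (nambuXiCT V μ K' (k, Y.2.1.2).1.2)‖)
        ≤ (1 / (β * (V : ℝ) ^ 2)) ^ 2 * (2 * (d * (16 : ℝ) ^ m * P₀ * (2 * klE0 + 1)) *
            ((Λ' * β / π + 3) * (1793 * Λ' * (V : ℝ) ^ 2 + 704 * V) * (4 * (β * (V : ℝ) ^ 2) / Λ))) := by
          gcongr
      _ = (1 / (β * (V : ℝ) ^ 2)) ^ 2 * ((Λ' * β / π + 3) * (1793 * Λ' * (V : ℝ) ^ 2 + 704 * V)) *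
            (β * (V : ℝ) ^ 2 * (8 * d * (16 : ℝ) ^ m * (2 * klE0 + 1) / Λ * P₀)) := by ring
      _ ≤ (Λ' / π + 3) * (1793 * Λ' + 704) * (8 * d * (16 : ℝ) ^ m * (2 * klE0 + 1) / Λ * P₀) :=
          shell_prefactor_le hβ1 hΛ'pos.le (by positivity)
      _ = _ := by ring
  -- (ii) the covariance piece: symbol increment summed over both shells
  have hcov : ‖((sectorSubMatrix V M β F).transpose * (C' - C) * sectorSubMatrix V M β F) X Y‖ ≤
      (Λ' / π + 3) * (1793 * Λ' + 704) * (2 * (16 * (32 / 3) + 16) / Λ ^ 2) * P₀ := by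
    rw [hC', hC, hubbardCovSliceCT_sub_eq_normalCovariance hβ.ne' μ K K' Λ Λ']
    have h1 := norm_sectorSub_pullback_normalCovariance_le_of_sum (L := V) (M := M) β F
      (fun ω k => by rw [hF]; exact norm_bgmFatMultiplier_le_one _ _ _ _ _ _)
      (fun ks : FreqMomentum V M × Fin 2 =>
        sliceSymbolFnXi (β * (V : ℝ) ^ 2) 0 Λ Λ' (matsubaraFreq β M ks.1.1) (nambuXiCT V μ K' ks.1.2) -
          sliceSymbolFnXi (β * (V : ℝ) ^ 2) 0 Λ Λ' (matsubaraFreq β M ks.1.1) (nambuXiCT V μ K ks.1.2)) X Y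
    refine h1.trans ?_
    have hc0 : ‖((1 / (β * (V : ℝ) ^ 2) : ℝ) : ℂ)‖ = 1 / (β * (V : ℝ) ^ 2) := by
      rw [Complex.norm_real, Real.norm_of_nonneg (by positivity)]
    rw [hc0]
    have hfull := sum_norm_sliceSymbolFreqIncr_le (V := V) (M := M) hK hK' hβ (c := β * (V : ℝ) ^ 2) (by positivity) hΛ hΛΛ' hΛ't hP₀ hv₀
    have hsub : ∑ k ∈ (univ : Finset (FreqMomentum V M)).filter (fun k => F X.2.1.1 k ≠ 0),
        ‖sliceSymbolFnXi (β * (V : ℝ) ^ 2) 0 Λ Λ' (matsubaraFreq β M (k, X.2.1.2).1.1) (nambuXiCT V μ K' (k, X.2.1.2).1.2) -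
          sliceSymbolFnXi (β * (V : ℝ) ^ 2) 0 Λ Λ' (matsubaraFreq β M (k, X.2.1.2).1.1) (nambuXiCT V μ K (k, X.2.1.2).1.2)‖ ≤
        ∑ k : FreqMomentum V M, ‖sliceSymbolFnXi (β * (V : ℝ) ^ 2) 0 Λ Λ' (matsubaraFreq β M k.1) (nambuXiCT V μ K' k.2) -
          sliceSymbolFnXi (β * (V : ℝ) ^ 2) 0 Λ Λ' (matsubaraFreq β M k.1) (nambuXiCT V μ K k.2)‖ :=
      Finset.sum_le_sum_of_subset_of_nonneg (filter_subset _ _) fun _ _ _ => norm_nonneg _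
    calc (1 / (β * (V : ℝ) ^ 2)) ^ 2 * ∑ k ∈ (univ : Finset (FreqMomentum V M)).filter (fun k => F X.2.1.1 k ≠ 0),
          ‖sliceSymbolFnXi (β * (V : ℝ) ^ 2) 0 Λ Λ' (matsubaraFreq β M (k, X.2.1.2).1.1) (nambuXiCT V μ K' (k, X.2.1.2).1.2) -
            sliceSymbolFnXi (β * (V : ℝ) ^ 2) 0 Λ Λ' (matsubaraFreq β M (k, X.2.1.2).1.1) (nambuXiCT V μ K (k, X.2.1.2).1.2)‖
        ≤ (1 / (β * (V : ℝ) ^ 2)) ^ 2 * (2 * ((Λ' * β / π + 3) * (1793 * Λ' * (V : ℝ) ^ 2 + 704 * V)) * ((16 * (32 / 3) + 16) * (β * (V : ℝ) ^ 2) / Λ ^ 2 * P₀)) :=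
          mul_le_mul_of_nonneg_left (hsub.trans hfull) (by positivity)
      _ = (1 / (β * (V : ℝ) ^ 2)) ^ 2 * ((Λ' * β / π + 3) * (1793 * Λ' * (V : ℝ) ^ 2 + 704 * V)) *
            (β * (V : ℝ) ^ 2 * (2 * (16 * (32 / 3) + 16) / Λ ^ 2 * P₀)) := by ring
      _ ≤ (Λ' / π + 3) * (1793 * Λ' + 704) * (2 * (16 * (32 / 3) + 16) / Λ ^ 2 * P₀) := shell_prefactor_le hβ1 hΛ'pos.le (by positivity)
      _ = _ := by ring
  calc _ ≤ (Λ' / π + 3) * (1793 * Λ' + 704) * (8 * d * (16 : ℝ) ^ m * (2 * klE0 + 1) / Λ) * P₀ +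
        (Λ' / π + 3) * (1793 * Λ' + 704) * (2 * (16 * (32 / 3) + 16) / Λ ^ 2) * P₀ := add_le_add hfam hcov
    _ = _ := by ring

end StepEntry

end Summit.HubbardSuperconductivity.HubbardSuperconductivity.Theorems.TorusFourierL2

end
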